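import Literature.Probability.RandomPlanarGeometry.HexSAWPolygonStepTwoImageTop
import Literature.Probability.RandomPlanarGeometry.HexSAWPolygonStepTwoStrictBase
import HarnessLib

/-!
# XLVIII — a STRICT step two from one witness: `q_N(ℍ) < q_{N+2}(ℍ)` whenever some `(N+2)`-gon has a three-contact top; hence `q_12 < q_14` structurally

Topic `Literature/Probability/RandomPlanarGeometry` (lane «pcv-sawmu», a-p4 g23; sequel of XXXII `HexSAWPolygonStepTwoOmega` (`stepTwoMap`, `canonOf_spec`,
`normInterior_spec`, `stepTwoMap_mem_canonEnd`, `stepTwoMap_injOn_of_omega_injective`), XLIV `HexSAWPolygonStepTwo` (`omegaImage_injective`), XLVI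
`HexSAWPolygonStepTwoImageTop` (`not_three_contacts_top_omegaImage`) and XLVII `HexSAWPolygonStepTwoStrictBase` (the rhombus)).

* ★★ `hexPolygonNumber_lt_add_two_of_witness` — if `T` is a cell polygon (brick set, polygonal boundary) of perimeter `N + 2` whose top hexagon `w` has its
  three lower neighbours `L w, LL w, LR w` in `T`, then `hexPolygonNumber N < hexPolygonNumber (N + 2)` (even `N ≥ 12`): the canonical rooted polygon of
  `bdry T` lies in `canonEnd (n+2)` but not in the image of the injection Φ of XXXII — an image would make `T` a translate of some `ι S₀`, whose top has at
  most two contacts (XLVI).  This reduces the STRICT step two for every even `N ≥ 12` to exhibiting one such `T` of each even perimeter `≥ 14`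
  (HANDOFF-gen23 §3: the two-row rhombi and their widenings);
* ★ `hexPolygonNumber_twelve_lt_fourteen'` — `q_12(ℍ) < q_14(ℍ)` from the rhombus of XLVII (a structural proof; the census `2 < 12` is in `HexSAWPolygonCensus`).

Sources: N. Madras, G. Slade, *The Self-Avoiding Walk* (1993), §3.2, Theorem 3.2.3 (3.2.3) and its proof pp. 64–65, Definition 3.2.2 p. 63 [MadrasSlade1993];
I. Jensen, J. Phys.: Conf. Ser. 42 (2006) 163, §2 [Jensen2006HoneycombPolygons].  Label (lane): LANE THEOREM (the strict step two reduced to a witness,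
with `q_12 < q_14` as the first case); the `ℍ` statements are the lane's, not the sources'.
-/

open Finset Literature.Probability.LatticeModels
open Literature.Barriers.CriticalPhenomena.SupercriticalSAW (shiftEdges)

namespace Literature.Probability.RandomPlanarGeometry.SAW

namespace HexCell

open HexBW HexBW.PolygonConcat

/-- Membership of a translated hexagon in a translated set. [cite: MadrasSlade1993, Definition 3.2.2 p. 63] -/
theorem shiftCell_mem_image_iff (z : Site 2) {S : Finset Cell} {c : Cell} : shiftCell z c ∈ S.image (shiftCell z) ↔ c ∈ S := by
  constructor
  · intro h
    obtain ⟨d, hd, hdc⟩ := mem_image.1 h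
    rw [shiftCell_injective z hdc] at hd; exact hd
  · exact fun h => mem_image_of_mem _ h

/-- ★★ **A strict step two from one witness.** If some brick set `T` with polygonal boundary of `N + 2` bonds has a top hexagon `w` whose three lower neighbours
`L w`, `LL w`, `LR w` all lie in `T`, then `hexPolygonNumber N < hexPolygonNumber (N + 2)` for even `N ≥ 12`: such a `T` is no translate of an OMEGA image
(XLVI), so the canonical polygon of `bdry T` is missed by the injection Φ of XXXII. [cite: MadrasSlade1993, §3.2, Theorem 3.2.3 (3.2.3) and its proof pp. 64–65] -/
theorem hexPolygonNumber_lt_add_two_of_witness {N : ℕ} (hN : 12 ≤ N) (hE : Even N) {T : Finset Cell} {w : Cell} (hT : IsBrickSet T)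
    (hP : IsPolygon brickWallGraph (bdry T)) (hper : perim T = N + 2) (hw : IsLexmax T w) (h3 : L w ∈ T ∧ LL w ∈ T ∧ LR w ∈ T) :
    hexPolygonNumber N < hexPolygonNumber (N + 2) := by
  classical
  obtain ⟨n, rfl⟩ : ∃ n, N = n + 1 := ⟨N - 1, by omega⟩
  rw [← card_canonEnd (by omega), show n + 1 + 2 = (n + 2) + 1 by ring, ← card_canonEnd (by omega)]
  -- Φ is injective on `canonEnd n` and lands in `canonEnd (n+2)`
  have hinj : Set.InjOn (stepTwoMap n) (canonEnd n : Set (ℕ → Site 2)) :=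
    stepTwoMap_injOn_of_omega_injective (by omega) fun S₁ S₂ h₁ h₂ hP₁ hP₂ _ _ h2₁ h2₂ _ _ heq =>
      omegaImage_injective S₁ S₂ ⟨h₁, hP₁, h2₁⟩ ⟨h₂, hP₂, h2₂⟩ heq
  have hmaps : ∀ ζ ∈ canonEnd n, stepTwoMap n ζ ∈ canonEnd (n + 2) := fun ζ hζ => (stepTwoMap_mem_canonEnd (by omega) hζ).1
  -- the witness' canonical polygon
  have hcard : #(bdry T) = (n + 2) + 1 := by rw [card_bdry hT, hper]
  obtain ⟨hζ', z, hz, he'⟩ := canonOf_spec hP hcard (by omega)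
  set ζ' := canonOf (n + 2) (bdry T)
  -- it is not in the image of Φ
  have hnot : ζ' ∉ (canonEnd n).image (stepTwoMap n) := by
    intro hmem
    obtain ⟨ζ, hζ, hζe⟩ := mem_image.1 hmem
    obtain ⟨-, -, -, -, hS₀b, -, hpoly, -, -, h2⟩ := normInterior_spec (n := n) (by omega) hζ
    obtain ⟨-, z₂, hz₂, he₂⟩ := stepTwoMap_mem_canonEnd (n := n) (by omega) hζ
    set S₀ := normalize (interiorOf (brickLoopEdges n ζ))
    obtain ⟨hTb, -, -⟩ := theoremV hS₀b hpoly h2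
    rw [hζe, he'] at he₂
    -- `bdry T` is a translate of `bdry (ι S₀)`, hence `T` is a translate of `ι S₀`
    have hE : bdry T = shiftEdges (z₂ + -z) (bdry (omegaImage S₀)) := by
      have := congrArg (shiftEdges (-z)) he₂
      rwa [shiftEdges_shiftEdges, shiftEdges_shiftEdges, add_neg_cancel, shiftEdges_zero] at this
    have hv : Even ((z₂ + -z) 0 + (z₂ + -z) 1) := by
      simp only [Pi.add_apply, Pi.neg_apply]; rw [Int.even_iff]; omega
    rw [← bdry_image_shiftCell] at hE
    have hTeq : T = (omegaImage S₀).image (shiftCell (z₂ + -z)) := eq_of_bdry_eq hT (isBrickSet_image_shiftCell hv hTb) hE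
    -- pull the top of `T` back to the top of `ι S₀`
    obtain ⟨w₀, hw₀, rfl⟩ := mem_image.1 (hTeq ▸ hw.1)
    have hw₀max : IsLexmax (omegaImage S₀) w₀ := by
      refine ⟨hw₀, fun c hc => ?_⟩
      have := hw.2 (shiftCell (z₂ + -z) c) (hTeq ▸ mem_image_of_mem _ hc)
      simp only [shiftCell_fst, shiftCell_snd] at this
      omega
    have eL : L (shiftCell (z₂ + -z) w₀) = shiftCell (z₂ + -z) (L w₀) := Prod.ext (by simp; ring) (by simp)
    have eLL : LL (shiftCell (z₂ + -z) w₀) = shiftCell (z₂ + -z) (LL w₀) := Prod.ext (by simp; ring) (by simp; ring)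
    have eLR : LR (shiftCell (z₂ + -z) w₀) = shiftCell (z₂ + -z) (LR w₀) := Prod.ext (by simp; ring) (by simp; ring)
    obtain ⟨hL, hLL, hLR⟩ := h3
    rw [hTeq] at hL hLL hLR
    rw [eL, shiftCell_mem_image_iff] at hL
    rw [eLL, shiftCell_mem_image_iff] at hLL
    rw [eLR, shiftCell_mem_image_iff] at hLR
    exact not_three_contacts_top_omegaImage hS₀b hpoly h2 hw₀max ⟨hL, hLL, hLR⟩
  -- count
  have himg : #((canonEnd n).image (stepTwoMap n)) = #(canonEnd n) := card_image_of_injOn hinj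
  have hsub : insert ζ' ((canonEnd n).image (stepTwoMap n)) ⊆ canonEnd (n + 2) := by
    intro x hx
    rcases mem_insert.1 hx with rfl | hx
    · exact hζ'
    · obtain ⟨ζ, hζ, rfl⟩ := mem_image.1 hx; exact hmaps ζ hζ
  have := card_le_card hsub
  rw [card_insert_of_notMem hnot, himg] at this
  omega

/-- ★ **`q_12(ℍ) < q_14(ℍ)` by structure** (not by census): the rhombus `{LL w, L w, LR w, w}` (`w = (0, 0)`) is a `14`-gon whose top hexagon has three
contacts (XLVII), so it is missed by OMEGA. [cite: MadrasSlade1993, §3.2, Theorem 3.2.3 (3.2.3)] [cite: Jensen2006HoneycombPolygons, §2 (p_12 = 2, p_14 = 12)] -/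
theorem hexPolygonNumber_twelve_lt_fourteen' : hexPolygonNumber 12 < hexPolygonNumber 14 := by
  have h0 : Even (((0, 0) : Cell).1 + ((0, 0) : Cell).2) := by simp
  obtain ⟨hP, hper⟩ := isPolygon_bdry_rhombus h0
  obtain ⟨hmax, hL, hLL, hLR⟩ := rhombus_top_contacts ((0, 0) : Cell)
  have hT : IsBrickSet ({LL (0, 0), L (0, 0), LR (0, 0), (0, 0)} : Finset Cell) := by
    intro x hx; simp only [mem_insert, mem_singleton] at hx
    rcases hx with rfl | rfl | rfl | rfl <;> simp [LL, L, LR]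
  exact hexPolygonNumber_lt_add_two_of_witness (by norm_num) (by decide) hT hP hper hmax ⟨hL, hLL, hLR⟩

end HexCell

end Literature.Probability.RandomPlanarGeometry.SAW
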